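import Literature.Topology.PlaneTopology.OsgoodFatLoopVolume
import Literature.Probability.RandomPlanarGeometry.PolygonalDomains
import HarnessLib

/-!
# The fat Dobrushin domain of an Osgood arc

Topic: Topology / PlaneTopology, sequel to `OsgoodFatLoop.lean` and `OsgoodFatLoopVolume.lean`.
From an Osgood arc `γ` (`IsOsgoodArc γ`) those files assemble the fat Jordan loop
`OsgoodDomain.fatLoop γ` through `0` (right branch `0 → 1` of dyadic copies of the arc, the
segments `1 → -2i → -1`, the mirrored left branch `-1 → 0`) and show that its boundary arcs at
`0` have positive area. Here we build the Jordan domain it bounds, as a Dobrushin domain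
`(D; 0, -2i)` (`OsgoodDomain.fatDomain`, via `JordanDomain.ofLoop` of `PolygonalDomains.lean`,
marks at the parameters `0` and `1/2`), and prove the elementary facts used by "fat germ"
arguments about chordal curve families:

* `fatDomain_pt_zero`, `fatDomain_pt_one` — the marked points are `0` and `-2i`;
* `fatDomain_carrier` — the carrier is the inside of the fat loop;
* `fatTriangle_subset_carrier` — the open triangle `±1, -2i` below the real axis (it is off the
  loop) lies in the domain: local two-sidedness of the loop at the point `1/2 - i` of the
  segment `1 → -2i` (`IsJordanLoop.subset_inside_or_of_nhds`), the far side being outside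
  because it leaves the closed half-plane `{2 re - im ≤ 2}` containing the loop; hence the lower
  half-disc of radius `1/2` at `0` and the vertical chord `{-ti | 0 < t < 2}` lie in the domain
  (`mem_carrier_of_norm_lt`, `neg_mul_I_mem_carrier`);
* `ofReal_not_mem_carrier` — the real points `± 2⁻ⁿ · 5/8` are on the loop, hence off the
  domain; `exists_im_pos` — the arc has a point in the open upper half-plane (else its trace
  would lie on the real line, a null set), so `exists_not_mem_carrier_im_pos` — arbitrarily
  close to `0` there are points of the open upper half-plane off the domain.

Everything is elementary and [folklore] (W. F. Osgood, Trans. AMS 4 (1903), 107–112, for the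
arc). Mathlib: `Convex`, `convex_halfSpace_lt`, `Measure.addHaar_submodule`; the tree: `IsJordanLoop`,
`JordanDomain.ofLoop`, `MarkedDomain`.
-/

noncomputable section

open Set Function Complex Metric Bornology _root_.MeasureTheory
open _root_.Topology
open scoped ComplexConjugate Pointwise
open Literature.Probability.RandomPlanarGeometry

namespace Literature.Topology.PlaneTopology

namespace OsgoodDomain

variable {γ : ℝ → ℂ}

/-! ### The domain -/

/-- **The fat Dobrushin domain** `(D; 0, -2i)`: the inside of the fat loop `fatLoop γ`
(`JordanDomain.ofLoop`), marked at the parameters `0` (the point `0`) and `1/2` (the point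
`-2i`). [folklore] -/
def fatDomain (h : IsOsgoodArc γ) : MarkedDomain 2 where
  toJordanDomain := JordanDomain.ofLoop (isJordanLoop_fatLoop h).continuous
    (isJordanLoop_fatLoop h).periodic (isJordanLoop_fatLoop h).injOn
  mark := ![0, 1 / 2]
  strictMono_mark := by
    refine Fin.strictMono_iff_lt_succ.2 fun k ↦ ?_
    fin_cases k
    simp
  mark_mem k := by fin_cases k <;> norm_num

/-- The boundary loop of the fat domain is the fat loop. [folklore] -/
@[simp] theorem fatDomain_boundary (h : IsOsgoodArc γ) : (fatDomain h).boundary = fatLoop γ := rfl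

/-- The first mark is the parameter `0`. [folklore] -/
@[simp] theorem fatDomain_mark_zero (h : IsOsgoodArc γ) : (fatDomain h).mark 0 = 0 := rfl

/-- The second mark is the parameter `1/2`. [folklore] -/
@[simp] theorem fatDomain_mark_one (h : IsOsgoodArc γ) : (fatDomain h).mark 1 = 1 / 2 := rfl

/-- The first marked point is `0`. [folklore] -/
theorem fatDomain_pt_zero (h : IsOsgoodArc γ) : (fatDomain h).pt 0 = 0 := by
  show fatLoop γ ((fatDomain h).mark 0) = 0
  rw [fatDomain_mark_zero, fatLoop_zero h]

/-- The second marked point is `-2i`. [folklore] -/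
theorem fatDomain_pt_one (h : IsOsgoodArc γ) : (fatDomain h).pt 1 = -2 * I := by
  show fatLoop γ ((fatDomain h).mark 1) = -2 * I
  rw [fatDomain_mark_one, fatLoop_half h]

/-- **The carrier of the fat domain is the inside of the fat loop.** [folklore] -/
theorem fatDomain_carrier (h : IsOsgoodArc γ) :
    (fatDomain h).carrier = IsJordanLoop.inside (fatLoop γ) :=
  ((fatDomain h).toJordanDomain.inside_boundary_eq_carrier).symm

/-- The carrier misses the loop. [folklore] -/
theorem fatDomain_carrier_subset_compl (h : IsOsgoodArc γ) :
    (fatDomain h).carrier ⊆ (range (fatLoop γ))ᶜ :=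
  JordanDomain.ofLoop_carrier_subset_compl _ _ _

/-! ### The triangle below the real axis lies inside -/

/-- **The fat triangle**: the open triangle with vertices `±1` and `-2i` below the real axis,
`{im < 0, 2 re - im < 2, -2 re - im < 2}`. [folklore] -/
def fatTriangle : Set ℂ := {z : ℂ | z.im < 0 ∧ 2 * z.re - z.im < 2 ∧ -2 * z.re - z.im < 2}

/-- Membership in the fat triangle. [folklore] -/
theorem mem_fatTriangle {z : ℂ} :
    z ∈ fatTriangle ↔ z.im < 0 ∧ 2 * z.re - z.im < 2 ∧ -2 * z.re - z.im < 2 := Iff.rfl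

/-- The fat triangle is convex. [folklore] -/
theorem convex_fatTriangle : Convex ℝ fatTriangle := by
  have hlin : ∀ a b : ℝ, IsLinearMap ℝ fun z : ℂ => a * z.re + b * z.im := fun a b =>
    ⟨fun x y => by simp only [add_re, add_im]; ring,
      fun c x => by simp only [smul_re, smul_im, smul_eq_mul]; ring⟩
  have h1 := convex_halfSpace_lt (hlin 0 1) (0 : ℝ)
  have h2 := convex_halfSpace_lt (hlin 2 (-1)) (2 : ℝ)
  have h3 := convex_halfSpace_lt (hlin (-2) (-1)) (2 : ℝ)
  have he : fatTriangle = {z : ℂ | 0 * z.re + 1 * z.im < 0} ∩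
      ({z : ℂ | 2 * z.re + (-1) * z.im < 2} ∩ {z : ℂ | (-2) * z.re + (-1) * z.im < 2}) := by
    ext z
    simp only [mem_fatTriangle, mem_inter_iff, mem_setOf_eq]
    constructor <;> rintro ⟨ha, hb, hc⟩ <;> exact ⟨by linarith, by linarith, by linarith⟩
  rw [he]
  exact h1.inter (h2.inter h3)

/-- The fat triangle misses the fat loop. [folklore] -/
theorem fatTriangle_subset_compl_range (h : IsOsgoodArc γ) :
    fatTriangle ⊆ (range (fatLoop γ))ᶜ := by
  intro z hz hmem
  rw [mem_fatTriangle] at hz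
  rcases range_fatLoop_subset h hmem with ⟨h1, -, -⟩ | ⟨h1, -, -⟩ | ⟨h1, -, -⟩
  · linarith [hz.1]
  · linarith [hz.2.1]
  · linarith [hz.2.2]

/-- Coordinates in the ball of radius `1/2` about `1/2 - i`. [folklore] -/
theorem re_im_of_mem_ball {z : ℂ} (hz : z ∈ ball (segA (1 / 2)) (1 / 2)) :
    0 < z.re ∧ z.re < 1 ∧ z.im < -1 / 2 ∧ -3 / 2 < z.im := by
  rw [mem_ball, dist_eq_norm] at hz
  have hre := abs_lt.1 (lt_of_le_of_lt (abs_re_le_norm (z - segA (1 / 2))) hz)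
  have him := abs_lt.1 (lt_of_le_of_lt (abs_im_le_norm (z - segA (1 / 2))) hz)
  simp only [sub_re, sub_im, segA_re, segA_im] at hre him
  refine ⟨?_, ?_, ?_, ?_⟩ <;> linarith [hre.1, hre.2, him.1, him.2]

/-- The far side of the segment `1 → -2i` near `1/2 - i` misses the loop. [folklore] -/
theorem farSide_subset_compl_range (h : IsOsgoodArc γ) :
    ball (segA (1 / 2)) (1 / 2) ∩ {z : ℂ | (-2) * z.re + 1 * z.im < -2} ⊆ (range (fatLoop γ))ᶜ := by
  rintro z ⟨hz, hz'⟩ hmem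
  obtain ⟨h1, -, h3, -⟩ := re_im_of_mem_ball hz
  simp only [mem_setOf_eq] at hz'
  rcases range_fatLoop_subset h hmem with ⟨h5, -, -⟩ | ⟨h5, -, -⟩ | ⟨-, -, h5⟩
  · linarith
  · linarith
  · linarith

/-- The point `3/4 - i` of the far side is outside the loop: it is off the closed half-plane
`{2 re - im ≤ 2}` containing the loop. [folklore] -/
theorem farPoint_mem_outside (h : IsOsgoodArc γ) :
    ((3 / 4 : ℝ) : ℂ) + ((-1 : ℝ) : ℂ) * I ∈ IsJordanLoop.outside (fatLoop γ) := by
  apply IsJordanLoop.mem_outside_of_not_mem_closure_convexHull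
  have hlin : ∀ a b : ℝ, IsLinearMap ℝ fun z : ℂ => a * z.re + b * z.im := fun a b =>
    ⟨fun x y => by simp only [add_re, add_im]; ring,
      fun c x => by simp only [smul_re, smul_im, smul_eq_mul]; ring⟩
  set K : Set ℂ := {z : ℂ | 2 * z.re + (-1) * z.im ≤ 2} with hK
  have hKc : Convex ℝ K := convex_halfSpace_le (hlin 2 (-1)) 2
  have hKcl : IsClosed K := isClosed_le (by fun_prop) continuous_const
  have hsub : range (fatLoop γ) ⊆ K := by
    intro z hz
    rw [hK, mem_setOf_eq]
    rcases range_fatLoop_subset h hz with ⟨h1, -, h3⟩ | ⟨h1, -, -⟩ | ⟨h1, -, h3⟩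
    · linarith
    · linarith
    · linarith
  intro hmem
  have := closure_minimal (convexHull_min hsub hKc) hKcl hmem
  rw [hK, mem_setOf_eq] at this
  simp at this
  linarith

/-- **The fat triangle lies inside the fat loop** (local two-sidedness at `1/2 - i`).
[folklore] -/
theorem fatTriangle_subset_inside (h : IsOsgoodArc γ) :
    fatTriangle ⊆ IsJordanLoop.inside (fatLoop γ) := by
  have hlin : ∀ a b : ℝ, IsLinearMap ℝ fun z : ℂ => a * z.re + b * z.im := fun a b =>
    ⟨fun x y => by simp only [add_re, add_im]; ring,
      fun c x => by simp only [smul_re, smul_im, smul_eq_mul]; ring⟩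
  have hJ := isJordanLoop_fatLoop h
  have hx : segA (1 / 2) ∈ range (fatLoop γ) := segA_mem_range h ⟨by norm_num, by norm_num⟩
  have hcover : ball (segA (1 / 2)) (1 / 2) \ range (fatLoop γ) ⊆
      fatTriangle ∪ (ball (segA (1 / 2)) (1 / 2) ∩ {z : ℂ | (-2) * z.re + 1 * z.im < -2}) := by
    rintro z ⟨hz, hzγ⟩
    obtain ⟨h1, h2, h3, h4⟩ := re_im_of_mem_ball hz
    rcases lt_trichotomy (2 * z.re - 2) z.im with hlt | heq | hgt
    · exact Or.inl ⟨by linarith, by linarith, by linarith⟩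
    · refine absurd ?_ hzγ
      have hzeq : z = segA (1 - z.re) := by
        apply Complex.ext
        · simp
        · simp only [segA_im]; linarith
      rw [hzeq]
      exact segA_mem_range h ⟨by linarith, by linarith⟩
    · exact Or.inr ⟨hz, by simp only [mem_setOf_eq]; linarith⟩
  rcases hJ.subset_inside_or_of_nhds hx (ball_mem_nhds _ (by norm_num)) hcover
    convex_fatTriangle.isPreconnected
    ((convex_ball _ _).inter (convex_halfSpace_lt (hlin (-2) 1) _)).isPreconnected
    (fatTriangle_subset_compl_range h) (farSide_subset_compl_range h) with ⟨h1, -⟩ | ⟨-, h2⟩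
  · exact h1
  · exfalso
    have hP : ((3 / 4 : ℝ) : ℂ) + ((-1 : ℝ) : ℂ) * I ∈
        ball (segA (1 / 2)) (1 / 2) ∩ {z : ℂ | (-2) * z.re + 1 * z.im < -2} := by
      refine ⟨?_, ?_⟩
      · rw [mem_ball, dist_eq_norm]
        have : ((3 / 4 : ℝ) : ℂ) + ((-1 : ℝ) : ℂ) * I - segA (1 / 2) = ((1 / 4 : ℝ) : ℂ) := by
          apply Complex.ext <;> norm_num
        rw [this, Complex.norm_real]
        norm_num
      · simp only [mem_setOf_eq]
        simp
        norm_num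
    exact Set.disjoint_left.1 IsJordanLoop.disjoint_inside_outside (h2 hP) (farPoint_mem_outside h)

/-- **The fat triangle lies in the fat domain.** [folklore] -/
theorem fatTriangle_subset_carrier (h : IsOsgoodArc γ) : fatTriangle ⊆ (fatDomain h).carrier := by
  rw [fatDomain_carrier]
  exact fatTriangle_subset_inside h

/-- The open lower half-disc of radius `1/2` at `0` lies in the fat domain. [folklore] -/
theorem mem_carrier_of_norm_lt (h : IsOsgoodArc γ) {w : ℂ} (hw : ‖w‖ < 1 / 2) (hw' : w.im < 0) :
    w ∈ (fatDomain h).carrier := by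
  refine fatTriangle_subset_carrier h ⟨hw', ?_, ?_⟩
  · have := abs_le.1 ((abs_re_le_norm w).trans hw.le)
    have := abs_le.1 ((abs_im_le_norm w).trans hw.le)
    linarith [this.1]
  · have := abs_le.1 ((abs_re_le_norm w).trans hw.le)
    have := abs_le.1 ((abs_im_le_norm w).trans hw.le)
    linarith [this.1]

/-- The open vertical chord from `0` to `-2i` lies in the fat domain. [folklore] -/
theorem neg_mul_I_mem_carrier (h : IsOsgoodArc γ) {t : ℝ} (h0 : 0 < t) (h2 : t < 2) :
    -((t : ℂ) * I) ∈ (fatDomain h).carrier := by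
  refine fatTriangle_subset_carrier h ⟨?_, ?_, ?_⟩ <;> simp <;> linarith

/-! ### Boundary points near `0` -/

/-- **The real points `± 2⁻ⁿ · 5/8` are off the fat domain** (they are on the loop: `5/8` is the
point `fatPiece γ (3/4)` of the real segment of the piece). [folklore] -/
theorem ofReal_not_mem_carrier (h : IsOsgoodArc γ) (n : ℕ) :
    ((((2 : ℝ) ^ n)⁻¹ * (5 / 8) : ℝ) : ℂ) ∉ (fatDomain h).carrier ∧
      -((((2 : ℝ) ^ n)⁻¹ * (5 / 8) : ℝ) : ℂ) ∉ (fatDomain h).carrier := by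
  have hval : ((2 : ℝ) ^ n)⁻¹ • fatPiece γ (3 / 4) = ((((2 : ℝ) ^ n)⁻¹ * (5 / 8) : ℝ) : ℂ) := by
    rw [fatPiece_of_gt (by norm_num), Complex.real_smul, ← ofReal_mul]
    norm_num
  obtain ⟨h1, h2⟩ := smul_fatPiece_mem_range h n (θ := 3 / 4) ⟨by norm_num, by norm_num⟩
  rw [hval] at h1 h2
  rw [conj_ofReal] at h2
  exact ⟨fun hm => fatDomain_carrier_subset_compl h hm h1,
    fun hm => fatDomain_carrier_subset_compl h hm h2⟩

/-- **An Osgood arc has a point in the open upper half-plane** (otherwise its trace would lie on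
the real line, a Lebesgue-null set). [folklore] -/
theorem exists_im_pos (h : IsOsgoodArc γ) : ∃ s ∈ Icc (0 : ℝ) 1, 0 < (γ s).im := by
  by_contra hcon
  push Not at hcon
  have hsub : γ '' Icc 0 1 ⊆ (LinearMap.ker Complex.imLm : Set ℂ) := by
    rintro _ ⟨s, hs, rfl⟩
    rw [SetLike.mem_coe, LinearMap.mem_ker]
    change (γ s).im = 0
    exact le_antisymm (hcon s hs) (h.mem s hs).2.1
  have h0 : volume (LinearMap.ker Complex.imLm : Set ℂ) = 0 := by
    refine Measure.addHaar_submodule volume _ fun htop => ?_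
    have : (I : ℂ) ∈ LinearMap.ker Complex.imLm := htop ▸ Submodule.mem_top
    simp at this
  exact h.volume_pos.ne' (measure_mono_null hsub h0)

/-- **Points of the open upper half-plane off the fat domain, arbitrarily close to `0`**: the
copies `2⁻ⁿ • (3/4 + γ s / 4)` of a point `γ s` of the arc with `im γ s > 0`. [folklore] -/
theorem exists_not_mem_carrier_im_pos (h : IsOsgoodArc γ) (n : ℕ) :
    ∃ w : ℂ, ‖w‖ ≤ 2 * ((2 : ℝ) ^ n)⁻¹ ∧ 0 < w.im ∧ w ∉ (fatDomain h).carrier := by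
  obtain ⟨s, hs, hpos⟩ := exists_im_pos h
  have hθ : (1 - s) / 2 ∈ Icc (0 : ℝ) 1 := ⟨by linarith [hs.2], by linarith [hs.1]⟩
  obtain ⟨h1, -⟩ := smul_fatPiece_mem_range h n hθ
  obtain ⟨hr1, hr2, hi1, hi2, -⟩ := fatPiece_mem h hθ
  refine ⟨((2 : ℝ) ^ n)⁻¹ • fatPiece γ ((1 - s) / 2), ?_, ?_,
    fun hm => fatDomain_carrier_subset_compl h hm h1⟩
  · rw [norm_smul, norm_inv, norm_pow, Real.norm_ofNat, mul_comm]
    refine mul_le_mul_of_nonneg_right ?_ (by positivity)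
    calc ‖fatPiece γ ((1 - s) / 2)‖ ≤ |(fatPiece γ ((1 - s) / 2)).re| +
        |(fatPiece γ ((1 - s) / 2)).im| := norm_le_abs_re_add_abs_im _
      _ ≤ 2 := by rw [abs_of_nonneg (by linarith), abs_of_nonneg hi1]; linarith
  · have him : (fatPiece γ ((1 - s) / 2)).im = (1 / 4) * (γ s).im := by
      rw [fatPiece_of_le (by linarith [hs.1]), show 1 - 2 * ((1 - s) / 2) = s by ring]
      simp
    rw [smul_im, smul_eq_mul, him]
    positivity

end OsgoodDomain

end Literature.Topology.PlaneTopology
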